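import Literature.NumberTheory.Sieve.DrappeauDispersionR1ppWeights
import HarnessLib

/-!
# Drappeau 2017, §5.5: the weights of the pieces satisfy the hypotheses of Theorem 2.1

Topic `Literature/NumberTheory/Sieve`, part of the formalisation of §5 of S. Drappeau, Proc. London
Math. Soc. (3) 114 (2017) 684–732 = arXiv:1504.05549, p. 20–21 ("(2.2) holds with
`ε₀ = O(δ)`").  For each pair of dyadic pieces, the five-variable weight
`g = drWeight (piece_j ∘ (q₀δ₂·)) (piece_i ∘ (q₀δ₁·)) κ 2^k R S'` is smooth, compactly supported,
supported in `(C,2C] × (D,2D] × (0,∞)³`, and satisfies the derivative bound (2.2) with the explicit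
family `KnuFamily Λ` (depending on `ν` and an absolute `Λ` only), provided the loss
`L = (2S+Y)/Y + 29` of the `γ`-pieces is absorbed: `L + 3 ≤ Λ t^{ε₀}` for `t ≥ (S−Y)/(q₀δ₁δ₂)`.
Everything proved; the only definition is the constant family `KnuFamily`.

## References

* S. Drappeau, Proc. London Math. Soc. (3) 114 (2017) 684–732, arXiv:1504.05549, §5.5 p. 20–21,
  Theorem 2.1 (2.2). [cite: Drappeau2017, §5.5]
-/

noncomputable section

open Finset Real Complex
open scoped ArithmeticFunction.Moebius FourierTransform ContDiff Topology

namespace Literature.NumberTheory.Sieve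

namespace Drappeau2017

open KloostermanQuintilinear

/-- The family `K_ν` of (2.2) for the weights of the pieces:
`K_ν = 36·DCS(ν₀)²DCS(ν₁)²·alphaMQ(ν₀+ν₁)·8·DCS(ν₂)DCS(ν₃)DCS(ν₄)·Λ^{ν₀+ν₁}·20^{ν₂}·10^{ν₃+ν₄}`.
[cite: Drappeau2017, Theorem 2.1 (2.2)] -/
def KnuFamily (Λ : ℝ) (ν : Fin 5 → ℕ) : ℝ :=
  (6 * derivConstSum (ν 0) ^ 2) * (6 * derivConstSum (ν 1) ^ 2) * alphaMQ (ν 0 + ν 1) *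
      (2 * derivConstSum (ν 2)) * (2 * derivConstSum (ν 3)) * (2 * derivConstSum (ν 4)) *
    (Λ ^ (ν 0) * Λ ^ (ν 1) * (5 / min 1 (1 / 4 : ℝ)) ^ (ν 2) * (5 / min 1 (1 / 2 : ℝ)) ^ (ν 3) *
      (5 / min 1 (1 / 2 : ℝ)) ^ (ν 4))

/-- `DerivBound` of the lower piece with the common constant `6·DCS²`. [folklore] -/
theorem derivBound_pieceLo' {S Y q₀ : ℝ} (hY : 0 < Y) (hYS : Y ≤ S / 4) (hq₀ : 0 < q₀) (k : ℕ)
    {t : ℝ} (ht : 0 < t) :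
    DerivBound (pieceLo S Y q₀) t k (6 * derivConstSum k ^ 2) (((2 * S + Y) / Y + 29) / t) := by
  have hS : 0 < S := by linarith
  have hD := one_le_derivConstSum k
  refine (derivBound_pieceLo hY hYS hq₀ k ht).mono le_rfl (by nlinarith) le_rfl (by positivity) ?_
  have : 0 ≤ (2 * S + Y) / Y + 29 := by positivity
  positivity

/-- Vanishing of the pieces near `t` with `(q₀δ) t < S − Y`, from `t < (S−Y)/(q₀δ₁δ₂)`. [folklore] -/
theorem lt_sub_of_lt_tmin {S Y q₀ : ℝ} (hq₀ : 0 < q₀) {δ δ' : ℕ} (hδ : 1 ≤ δ)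
    (hδ' : 1 ≤ δ') {t : ℝ} (ht0 : 0 < t) (ht : t < (S - Y) / (q₀ * ((δ : ℝ) * δ'))) :
    q₀ * (δ : ℝ) * t < S - Y ∧ q₀ * (δ' : ℝ) * t < S - Y := by
  have hδr : (1 : ℝ) ≤ δ := by exact_mod_cast hδ
  have hδr' : (1 : ℝ) ≤ δ' := by exact_mod_cast hδ'
  rw [lt_div_iff₀ (by positivity)] at ht
  constructor <;> nlinarith [mul_pos hq₀ ht0, mul_nonneg (mul_pos hq₀ ht0).le (sub_nonneg.2 hδr),
    mul_nonneg (mul_pos hq₀ ht0).le (sub_nonneg.2 hδr')]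


/-- **The weight `g_{XY}` satisfies the hypotheses of Theorem 2.1.** [cite: Drappeau2017, §5.5 p. 20–21] -/
theorem drWeight_cruxHyps_LL {S Y : ℝ} (hY : 0 < Y) (hYS : Y ≤ S / 4) {q₀ δ₁ δ₂ : ℕ} (hq₀ : 0 < q₀)
    (hδ₁ : 0 < δ₁) (hδ₂ : 0 < δ₂) {κ R S' : ℝ} (hκ : 0 ≤ κ) (hR : 1 ≤ R) (hS' : 1 ≤ S') (k : ℕ)
    {ε₀ Λ : ℝ} (hε₀ : 0 ≤ ε₀) (hε₁ : ε₀ ≤ 1) (hΛ : 0 ≤ Λ)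
    (hΛt : ∀ t : ℝ, (S - Y) / ((q₀ : ℝ) * ((δ₁ : ℝ) * δ₂)) ≤ t →
      (2 * S + Y) / Y + 29 + 3 ≤ Λ * t ^ ε₀) :
    ContDiff ℝ (⊤ : ℕ∞) (fun p : Fin 5 → ℝ => (drWeight (pieceLo S Y ((q₀ : ℝ) * δ₂)) (pieceLo S Y ((q₀ : ℝ) * δ₁))
          κ ((2 : ℝ) ^ k) R S') (p 0) (p 1) (p 2) (p 3) (p 4)) ∧
    HasCompactSupport (fun p : Fin 5 → ℝ => (drWeight (pieceLo S Y ((q₀ : ℝ) * δ₂)) (pieceLo S Y ((q₀ : ℝ) * δ₁))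
          κ ((2 : ℝ) ^ k) R S') (p 0) (p 1) (p 2) (p 3) (p 4)) ∧
    (∀ c d n r s : ℝ, (drWeight (pieceLo S Y ((q₀ : ℝ) * δ₂)) (pieceLo S Y ((q₀ : ℝ) * δ₁))
          κ ((2 : ℝ) ^ k) R S') c d n r s ≠ 0 →
      ((29 / 40 * S / ((q₀ : ℝ) * δ₂)) < c ∧ c ≤ 2 * (29 / 40 * S / ((q₀ : ℝ) * δ₂)) ∧ (29 / 40 * S / ((q₀ : ℝ) * δ₁)) < d ∧ d ≤ 2 * (29 / 40 * S / ((q₀ : ℝ) * δ₁)) ∧ 0 < n ∧ 0 < r ∧ 0 < s)) ∧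
    (∀ ν : Fin 5 → ℕ, ∀ c d n r s : ℝ, 0 < c → 0 < d → 0 < n → 0 < r → 0 < s →
      ‖mixedDeriv ν (drWeight (pieceLo S Y ((q₀ : ℝ) * δ₂)) (pieceLo S Y ((q₀ : ℝ) * δ₁))
          κ ((2 : ℝ) ^ k) R S') c d n r s‖ ≤ KnuFamily Λ ν *
        (c ^ (-(ν 0 : ℝ)) * d ^ (-(ν 1 : ℝ)) * n ^ (-(ν 2 : ℝ)) * r ^ (-(ν 3 : ℝ)) *
          s ^ (-(ν 4 : ℝ))) ^ (1 - ε₀)) := by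
  have hS : 0 < S := by linarith
  have hq₀r : (0 : ℝ) < q₀ := by exact_mod_cast hq₀
  have hδ₁r : (0 : ℝ) < δ₁ := by exact_mod_cast hδ₁
  have hδ₂r : (0 : ℝ) < δ₂ := by exact_mod_cast hδ₂
  have hAs : ∀ t, pieceLo S Y ((q₀ : ℝ) * δ₂) t ≠ 0 → (29 / 40 * S / ((q₀ : ℝ) * δ₂)) < t ∧ t ≤ 2 * (29 / 40 * S / ((q₀ : ℝ) * δ₂)) :=
    fun t ht => pieceLo_ne_zero hY hYS (by positivity) ht
  have hBs : ∀ t, pieceLo S Y ((q₀ : ℝ) * δ₁) t ≠ 0 → (29 / 40 * S / ((q₀ : ℝ) * δ₁)) < t ∧ t ≤ 2 * (29 / 40 * S / ((q₀ : ℝ) * δ₁)) :=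
    fun t ht => pieceLo_ne_zero hY hYS (by positivity) ht
  have hMn : (0 : ℝ) < (2 : ℝ) ^ k := by positivity
  refine ⟨contDiff_drWeight (contDiff_pieceLo S Y _) (contDiff_pieceLo S Y _) _ _ _ _,
    hasCompactSupport_drWeight hAs hBs _ hMn (by linarith) (by linarith),
    fun c d n r s h => drWeight_ne_zero hAs hBs _ hMn (by linarith) (by linarith) h, ?_⟩
  intro ν c d n r s hc hd hn hr hs
  have hL : 0 ≤ (2 * S + Y) / Y + 29 := by positivity
  have key := norm_mixedDeriv_drWeight_le (A := pieceLo S Y ((q₀ : ℝ) * δ₂))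
    (B := pieceLo S Y ((q₀ : ℝ) * δ₁)) (contDiff_pieceLo S Y _) (contDiff_pieceLo S Y _)
    (XA := fun k => 6 * derivConstSum k ^ 2) (XB := fun k => 6 * derivConstSum k ^ 2)
    (fun k => by positivity) (fun k => by positivity) hL
    (fun k t ht => derivBound_pieceLo' hY hYS (by positivity) k ht)
    (fun k t ht => derivBound_pieceLo' hY hYS (by positivity) k ht)
    (tmin := (S - Y) / ((q₀ : ℝ) * ((δ₁ : ℝ) * δ₂)))
    (fun t ht0 ht => pieceLo_eventuallyEq_zero hY hS.le
      (by have := (lt_sub_of_lt_tmin hq₀r hδ₁ hδ₂ ht0 ht).2; nlinarith))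
    (fun t ht0 ht => pieceLo_eventuallyEq_zero hY hS.le
      (by have := (lt_sub_of_lt_tmin hq₀r hδ₁ hδ₂ ht0 ht).1; nlinarith))
    hε₀ hε₁ hΛ hΛt hκ (show (1 : ℝ) / 2 ≤ (2 : ℝ) ^ k from by
      have h2 : (1 : ℝ) ≤ (2 : ℝ) ^ k := one_le_pow₀ (by norm_num)
      linarith) hR hS' ν hc hd hn hr hs
  unfold KnuFamily
  exact key

/-- **The weight `g_{XY}` satisfies the hypotheses of Theorem 2.1.** [cite: Drappeau2017, §5.5 p. 20–21] -/
theorem drWeight_cruxHyps_LH {S Y : ℝ} (hY : 0 < Y) (hYS : Y ≤ S / 4) {q₀ δ₁ δ₂ : ℕ} (hq₀ : 0 < q₀)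
    (hδ₁ : 0 < δ₁) (hδ₂ : 0 < δ₂) {κ R S' : ℝ} (hκ : 0 ≤ κ) (hR : 1 ≤ R) (hS' : 1 ≤ S') (k : ℕ)
    {ε₀ Λ : ℝ} (hε₀ : 0 ≤ ε₀) (hε₁ : ε₀ ≤ 1) (hΛ : 0 ≤ Λ)
    (hΛt : ∀ t : ℝ, (S - Y) / ((q₀ : ℝ) * ((δ₁ : ℝ) * δ₂)) ≤ t →
      (2 * S + Y) / Y + 29 + 3 ≤ Λ * t ^ ε₀) :
    ContDiff ℝ (⊤ : ℕ∞) (fun p : Fin 5 → ℝ => (drWeight (pieceHi S Y ((q₀ : ℝ) * δ₂)) (pieceLo S Y ((q₀ : ℝ) * δ₁))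
          κ ((2 : ℝ) ^ k) R S') (p 0) (p 1) (p 2) (p 3) (p 4)) ∧
    HasCompactSupport (fun p : Fin 5 → ℝ => (drWeight (pieceHi S Y ((q₀ : ℝ) * δ₂)) (pieceLo S Y ((q₀ : ℝ) * δ₁))
          κ ((2 : ℝ) ^ k) R S') (p 0) (p 1) (p 2) (p 3) (p 4)) ∧
    (∀ c d n r s : ℝ, (drWeight (pieceHi S Y ((q₀ : ℝ) * δ₂)) (pieceLo S Y ((q₀ : ℝ) * δ₁))
          κ ((2 : ℝ) ^ k) R S') c d n r s ≠ 0 →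
      ((9 / 8 * S / ((q₀ : ℝ) * δ₂)) < c ∧ c ≤ 2 * (9 / 8 * S / ((q₀ : ℝ) * δ₂)) ∧ (29 / 40 * S / ((q₀ : ℝ) * δ₁)) < d ∧ d ≤ 2 * (29 / 40 * S / ((q₀ : ℝ) * δ₁)) ∧ 0 < n ∧ 0 < r ∧ 0 < s)) ∧
    (∀ ν : Fin 5 → ℕ, ∀ c d n r s : ℝ, 0 < c → 0 < d → 0 < n → 0 < r → 0 < s →
      ‖mixedDeriv ν (drWeight (pieceHi S Y ((q₀ : ℝ) * δ₂)) (pieceLo S Y ((q₀ : ℝ) * δ₁))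
          κ ((2 : ℝ) ^ k) R S') c d n r s‖ ≤ KnuFamily Λ ν *
        (c ^ (-(ν 0 : ℝ)) * d ^ (-(ν 1 : ℝ)) * n ^ (-(ν 2 : ℝ)) * r ^ (-(ν 3 : ℝ)) *
          s ^ (-(ν 4 : ℝ))) ^ (1 - ε₀)) := by
  have hS : 0 < S := by linarith
  have hq₀r : (0 : ℝ) < q₀ := by exact_mod_cast hq₀
  have hδ₁r : (0 : ℝ) < δ₁ := by exact_mod_cast hδ₁
  have hδ₂r : (0 : ℝ) < δ₂ := by exact_mod_cast hδ₂
  have hAs : ∀ t, pieceHi S Y ((q₀ : ℝ) * δ₂) t ≠ 0 → (9 / 8 * S / ((q₀ : ℝ) * δ₂)) < t ∧ t ≤ 2 * (9 / 8 * S / ((q₀ : ℝ) * δ₂)) :=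
    fun t ht => pieceHi_ne_zero hY hYS (by positivity) ht
  have hBs : ∀ t, pieceLo S Y ((q₀ : ℝ) * δ₁) t ≠ 0 → (29 / 40 * S / ((q₀ : ℝ) * δ₁)) < t ∧ t ≤ 2 * (29 / 40 * S / ((q₀ : ℝ) * δ₁)) :=
    fun t ht => pieceLo_ne_zero hY hYS (by positivity) ht
  have hMn : (0 : ℝ) < (2 : ℝ) ^ k := by positivity
  refine ⟨contDiff_drWeight (contDiff_pieceHi S Y _) (contDiff_pieceLo S Y _) _ _ _ _,
    hasCompactSupport_drWeight hAs hBs _ hMn (by linarith) (by linarith),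
    fun c d n r s h => drWeight_ne_zero hAs hBs _ hMn (by linarith) (by linarith) h, ?_⟩
  intro ν c d n r s hc hd hn hr hs
  have hL : 0 ≤ (2 * S + Y) / Y + 29 := by positivity
  have key := norm_mixedDeriv_drWeight_le (A := pieceHi S Y ((q₀ : ℝ) * δ₂))
    (B := pieceLo S Y ((q₀ : ℝ) * δ₁)) (contDiff_pieceHi S Y _) (contDiff_pieceLo S Y _)
    (XA := fun k => 6 * derivConstSum k ^ 2) (XB := fun k => 6 * derivConstSum k ^ 2)
    (fun k => by positivity) (fun k => by positivity) hL
    (fun k t ht => derivBound_pieceHi hY hYS (by positivity) k ht)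
    (fun k t ht => derivBound_pieceLo' hY hYS (by positivity) k ht)
    (tmin := (S - Y) / ((q₀ : ℝ) * ((δ₁ : ℝ) * δ₂)))
    (fun t ht0 ht => pieceHi_eventuallyEq_zero hY hS.le
      (by have := (lt_sub_of_lt_tmin hq₀r hδ₁ hδ₂ ht0 ht).2; nlinarith))
    (fun t ht0 ht => pieceLo_eventuallyEq_zero hY hS.le
      (by have := (lt_sub_of_lt_tmin hq₀r hδ₁ hδ₂ ht0 ht).1; nlinarith))
    hε₀ hε₁ hΛ hΛt hκ (show (1 : ℝ) / 2 ≤ (2 : ℝ) ^ k from by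
      have h2 : (1 : ℝ) ≤ (2 : ℝ) ^ k := one_le_pow₀ (by norm_num)
      linarith) hR hS' ν hc hd hn hr hs
  unfold KnuFamily
  exact key

/-- **The weight `g_{XY}` satisfies the hypotheses of Theorem 2.1.** [cite: Drappeau2017, §5.5 p. 20–21] -/
theorem drWeight_cruxHyps_HL {S Y : ℝ} (hY : 0 < Y) (hYS : Y ≤ S / 4) {q₀ δ₁ δ₂ : ℕ} (hq₀ : 0 < q₀)
    (hδ₁ : 0 < δ₁) (hδ₂ : 0 < δ₂) {κ R S' : ℝ} (hκ : 0 ≤ κ) (hR : 1 ≤ R) (hS' : 1 ≤ S') (k : ℕ)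
    {ε₀ Λ : ℝ} (hε₀ : 0 ≤ ε₀) (hε₁ : ε₀ ≤ 1) (hΛ : 0 ≤ Λ)
    (hΛt : ∀ t : ℝ, (S - Y) / ((q₀ : ℝ) * ((δ₁ : ℝ) * δ₂)) ≤ t →
      (2 * S + Y) / Y + 29 + 3 ≤ Λ * t ^ ε₀) :
    ContDiff ℝ (⊤ : ℕ∞) (fun p : Fin 5 → ℝ => (drWeight (pieceLo S Y ((q₀ : ℝ) * δ₂)) (pieceHi S Y ((q₀ : ℝ) * δ₁))
          κ ((2 : ℝ) ^ k) R S') (p 0) (p 1) (p 2) (p 3) (p 4)) ∧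
    HasCompactSupport (fun p : Fin 5 → ℝ => (drWeight (pieceLo S Y ((q₀ : ℝ) * δ₂)) (pieceHi S Y ((q₀ : ℝ) * δ₁))
          κ ((2 : ℝ) ^ k) R S') (p 0) (p 1) (p 2) (p 3) (p 4)) ∧
    (∀ c d n r s : ℝ, (drWeight (pieceLo S Y ((q₀ : ℝ) * δ₂)) (pieceHi S Y ((q₀ : ℝ) * δ₁))
          κ ((2 : ℝ) ^ k) R S') c d n r s ≠ 0 →
      ((29 / 40 * S / ((q₀ : ℝ) * δ₂)) < c ∧ c ≤ 2 * (29 / 40 * S / ((q₀ : ℝ) * δ₂)) ∧ (9 / 8 * S / ((q₀ : ℝ) * δ₁)) < d ∧ d ≤ 2 * (9 / 8 * S / ((q₀ : ℝ) * δ₁)) ∧ 0 < n ∧ 0 < r ∧ 0 < s)) ∧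
    (∀ ν : Fin 5 → ℕ, ∀ c d n r s : ℝ, 0 < c → 0 < d → 0 < n → 0 < r → 0 < s →
      ‖mixedDeriv ν (drWeight (pieceLo S Y ((q₀ : ℝ) * δ₂)) (pieceHi S Y ((q₀ : ℝ) * δ₁))
          κ ((2 : ℝ) ^ k) R S') c d n r s‖ ≤ KnuFamily Λ ν *
        (c ^ (-(ν 0 : ℝ)) * d ^ (-(ν 1 : ℝ)) * n ^ (-(ν 2 : ℝ)) * r ^ (-(ν 3 : ℝ)) *
          s ^ (-(ν 4 : ℝ))) ^ (1 - ε₀)) := by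
  have hS : 0 < S := by linarith
  have hq₀r : (0 : ℝ) < q₀ := by exact_mod_cast hq₀
  have hδ₁r : (0 : ℝ) < δ₁ := by exact_mod_cast hδ₁
  have hδ₂r : (0 : ℝ) < δ₂ := by exact_mod_cast hδ₂
  have hAs : ∀ t, pieceLo S Y ((q₀ : ℝ) * δ₂) t ≠ 0 → (29 / 40 * S / ((q₀ : ℝ) * δ₂)) < t ∧ t ≤ 2 * (29 / 40 * S / ((q₀ : ℝ) * δ₂)) :=
    fun t ht => pieceLo_ne_zero hY hYS (by positivity) ht
  have hBs : ∀ t, pieceHi S Y ((q₀ : ℝ) * δ₁) t ≠ 0 → (9 / 8 * S / ((q₀ : ℝ) * δ₁)) < t ∧ t ≤ 2 * (9 / 8 * S / ((q₀ : ℝ) * δ₁)) :=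
    fun t ht => pieceHi_ne_zero hY hYS (by positivity) ht
  have hMn : (0 : ℝ) < (2 : ℝ) ^ k := by positivity
  refine ⟨contDiff_drWeight (contDiff_pieceLo S Y _) (contDiff_pieceHi S Y _) _ _ _ _,
    hasCompactSupport_drWeight hAs hBs _ hMn (by linarith) (by linarith),
    fun c d n r s h => drWeight_ne_zero hAs hBs _ hMn (by linarith) (by linarith) h, ?_⟩
  intro ν c d n r s hc hd hn hr hs
  have hL : 0 ≤ (2 * S + Y) / Y + 29 := by positivity
  have key := norm_mixedDeriv_drWeight_le (A := pieceLo S Y ((q₀ : ℝ) * δ₂))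
    (B := pieceHi S Y ((q₀ : ℝ) * δ₁)) (contDiff_pieceLo S Y _) (contDiff_pieceHi S Y _)
    (XA := fun k => 6 * derivConstSum k ^ 2) (XB := fun k => 6 * derivConstSum k ^ 2)
    (fun k => by positivity) (fun k => by positivity) hL
    (fun k t ht => derivBound_pieceLo' hY hYS (by positivity) k ht)
    (fun k t ht => derivBound_pieceHi hY hYS (by positivity) k ht)
    (tmin := (S - Y) / ((q₀ : ℝ) * ((δ₁ : ℝ) * δ₂)))
    (fun t ht0 ht => pieceLo_eventuallyEq_zero hY hS.le
      (by have := (lt_sub_of_lt_tmin hq₀r hδ₁ hδ₂ ht0 ht).2; nlinarith))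
    (fun t ht0 ht => pieceHi_eventuallyEq_zero hY hS.le
      (by have := (lt_sub_of_lt_tmin hq₀r hδ₁ hδ₂ ht0 ht).1; nlinarith))
    hε₀ hε₁ hΛ hΛt hκ (show (1 : ℝ) / 2 ≤ (2 : ℝ) ^ k from by
      have h2 : (1 : ℝ) ≤ (2 : ℝ) ^ k := one_le_pow₀ (by norm_num)
      linarith) hR hS' ν hc hd hn hr hs
  unfold KnuFamily
  exact key

/-- **The weight `g_{XY}` satisfies the hypotheses of Theorem 2.1.** [cite: Drappeau2017, §5.5 p. 20–21] -/
theorem drWeight_cruxHyps_HH {S Y : ℝ} (hY : 0 < Y) (hYS : Y ≤ S / 4) {q₀ δ₁ δ₂ : ℕ} (hq₀ : 0 < q₀)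
    (hδ₁ : 0 < δ₁) (hδ₂ : 0 < δ₂) {κ R S' : ℝ} (hκ : 0 ≤ κ) (hR : 1 ≤ R) (hS' : 1 ≤ S') (k : ℕ)
    {ε₀ Λ : ℝ} (hε₀ : 0 ≤ ε₀) (hε₁ : ε₀ ≤ 1) (hΛ : 0 ≤ Λ)
    (hΛt : ∀ t : ℝ, (S - Y) / ((q₀ : ℝ) * ((δ₁ : ℝ) * δ₂)) ≤ t →
      (2 * S + Y) / Y + 29 + 3 ≤ Λ * t ^ ε₀) :
    ContDiff ℝ (⊤ : ℕ∞) (fun p : Fin 5 → ℝ => (drWeight (pieceHi S Y ((q₀ : ℝ) * δ₂)) (pieceHi S Y ((q₀ : ℝ) * δ₁))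
          κ ((2 : ℝ) ^ k) R S') (p 0) (p 1) (p 2) (p 3) (p 4)) ∧
    HasCompactSupport (fun p : Fin 5 → ℝ => (drWeight (pieceHi S Y ((q₀ : ℝ) * δ₂)) (pieceHi S Y ((q₀ : ℝ) * δ₁))
          κ ((2 : ℝ) ^ k) R S') (p 0) (p 1) (p 2) (p 3) (p 4)) ∧
    (∀ c d n r s : ℝ, (drWeight (pieceHi S Y ((q₀ : ℝ) * δ₂)) (pieceHi S Y ((q₀ : ℝ) * δ₁))
          κ ((2 : ℝ) ^ k) R S') c d n r s ≠ 0 →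
      ((9 / 8 * S / ((q₀ : ℝ) * δ₂)) < c ∧ c ≤ 2 * (9 / 8 * S / ((q₀ : ℝ) * δ₂)) ∧ (9 / 8 * S / ((q₀ : ℝ) * δ₁)) < d ∧ d ≤ 2 * (9 / 8 * S / ((q₀ : ℝ) * δ₁)) ∧ 0 < n ∧ 0 < r ∧ 0 < s)) ∧
    (∀ ν : Fin 5 → ℕ, ∀ c d n r s : ℝ, 0 < c → 0 < d → 0 < n → 0 < r → 0 < s →
      ‖mixedDeriv ν (drWeight (pieceHi S Y ((q₀ : ℝ) * δ₂)) (pieceHi S Y ((q₀ : ℝ) * δ₁))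
          κ ((2 : ℝ) ^ k) R S') c d n r s‖ ≤ KnuFamily Λ ν *
        (c ^ (-(ν 0 : ℝ)) * d ^ (-(ν 1 : ℝ)) * n ^ (-(ν 2 : ℝ)) * r ^ (-(ν 3 : ℝ)) *
          s ^ (-(ν 4 : ℝ))) ^ (1 - ε₀)) := by
  have hS : 0 < S := by linarith
  have hq₀r : (0 : ℝ) < q₀ := by exact_mod_cast hq₀
  have hδ₁r : (0 : ℝ) < δ₁ := by exact_mod_cast hδ₁
  have hδ₂r : (0 : ℝ) < δ₂ := by exact_mod_cast hδ₂
  have hAs : ∀ t, pieceHi S Y ((q₀ : ℝ) * δ₂) t ≠ 0 → (9 / 8 * S / ((q₀ : ℝ) * δ₂)) < t ∧ t ≤ 2 * (9 / 8 * S / ((q₀ : ℝ) * δ₂)) :=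
    fun t ht => pieceHi_ne_zero hY hYS (by positivity) ht
  have hBs : ∀ t, pieceHi S Y ((q₀ : ℝ) * δ₁) t ≠ 0 → (9 / 8 * S / ((q₀ : ℝ) * δ₁)) < t ∧ t ≤ 2 * (9 / 8 * S / ((q₀ : ℝ) * δ₁)) :=
    fun t ht => pieceHi_ne_zero hY hYS (by positivity) ht
  have hMn : (0 : ℝ) < (2 : ℝ) ^ k := by positivity
  refine ⟨contDiff_drWeight (contDiff_pieceHi S Y _) (contDiff_pieceHi S Y _) _ _ _ _,
    hasCompactSupport_drWeight hAs hBs _ hMn (by linarith) (by linarith),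
    fun c d n r s h => drWeight_ne_zero hAs hBs _ hMn (by linarith) (by linarith) h, ?_⟩
  intro ν c d n r s hc hd hn hr hs
  have hL : 0 ≤ (2 * S + Y) / Y + 29 := by positivity
  have key := norm_mixedDeriv_drWeight_le (A := pieceHi S Y ((q₀ : ℝ) * δ₂))
    (B := pieceHi S Y ((q₀ : ℝ) * δ₁)) (contDiff_pieceHi S Y _) (contDiff_pieceHi S Y _)
    (XA := fun k => 6 * derivConstSum k ^ 2) (XB := fun k => 6 * derivConstSum k ^ 2)
    (fun k => by positivity) (fun k => by positivity) hL
    (fun k t ht => derivBound_pieceHi hY hYS (by positivity) k ht)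
    (fun k t ht => derivBound_pieceHi hY hYS (by positivity) k ht)
    (tmin := (S - Y) / ((q₀ : ℝ) * ((δ₁ : ℝ) * δ₂)))
    (fun t ht0 ht => pieceHi_eventuallyEq_zero hY hS.le
      (by have := (lt_sub_of_lt_tmin hq₀r hδ₁ hδ₂ ht0 ht).2; nlinarith))
    (fun t ht0 ht => pieceHi_eventuallyEq_zero hY hS.le
      (by have := (lt_sub_of_lt_tmin hq₀r hδ₁ hδ₂ ht0 ht).1; nlinarith))
    hε₀ hε₁ hΛ hΛt hκ (show (1 : ℝ) / 2 ≤ (2 : ℝ) ^ k from by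
      have h2 : (1 : ℝ) ≤ (2 : ℝ) ^ k := one_le_pow₀ (by norm_num)
      linarith) hR hS' ν hc hd hn hr hs
  unfold KnuFamily
  exact key

end Drappeau2017

end Literature.NumberTheory.Sieve

end
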